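import Literature.AlgebraicGeometry.AbelianSchemes.AbelianSchemeDualTransportUnit
import Literature.AlgebraicGeometry.AbelianSchemes.RigidifiedLineBundleTensor
import HarnessLib

/-!
# The unit hypothesis `𝒫|_{A × {ε_Â}} ≅ 𝒪` from a polarisation, over a reduced base

Layer `Literature/AlgebraicGeometry/AbelianSchemes`, namespace `Literature.AlgebraicGeometry.AbelianSchemes.AbelianSchemeOver`.
Cell `hodgecm-mathlib`, HECKE-LINK brick H2 file (ii): discharges the raw binder
`hD : Nonempty ((pullback (unitHatSlice D)).obj D.P ≅ 𝒪)` of ★ `AbelianSchemeDualTransport` §4 / ★ (P-⊗) `PoincareSheafBiadditive` /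
★ (SYM-n) `PoincareSheafMulN` / ★ (K1)(K2) `PoincareSheafMulNKernel` / ★ `PoincareStabilizerDualKernel` / ★ `PoincarePullbackTorsion` /
★ `DualIsogenyMulN` for every POLARISED abelian scheme over a reduced base (e.g. `Q`, `A′ = ι′^*𝓜′.univ` over the
piece `S″`).  THEOREMS ONLY.  Over a field this is ★ `nonempty_unitHatSlice_iso_of_isLambdaOfAt`; on each geometric fibre it is ★
`nonempty_pullback_fst_unitHatSlice_iso_of_isLambdaOfAt` ([MumfordFogartyKirwan1994] Def. 6.2: `Λ(L)|_{X × e}` is trivial); the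
passage from all geometric fibres to the reduced base is ★ (P-d) `nonempty_iso_unit_of_forall_fibre` ([MumfordAV1970] §5 Cor. 6,
§13) applied to the rigidified fibrewise-`Pic⁰` family `(1_A × ε_Â)^*𝒫` on `A_S = A ×_S S`.

* `DualPair.nonempty_unitHatSlice_iso_of_forall_isLambdaOfAt` — from a homomorphism `λ : A → Â` that is `Λ(𝒪(Θ_s))` at every geometric
  point;
* **`Polarization.nonempty_unitHatSlice_iso`** — from a ★ `Polarization D`.

HC_CM is proved only modulo the 7 printed citations until rung 0 closes; nothing here is about HC.

## References
* [MumfordFogartyKirwan1994] D. Mumford, J. Fogarty, F. Kirwan, *Geometric Invariant Theory*, 3rd ed. (1994), Ch. 6 §2 Definitions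
  6.2–6.3 (p. 120).
* [MumfordAV1970] D. Mumford, *Abelian Varieties* (1970), §5 Cor. 6 (p. 54), §13 (p. 125).
* [MilneAV2008] J. S. Milne, *Abelian Varieties* (v2.00, 2008), I §8 pp. 36–37.
-/

noncomputable section

universe u

open CategoryTheory CategoryTheory.Limits AlgebraicGeometry MonoidalCategory CartesianMonoidalCategory
open scoped MonObj

-- `Scheme.Modules` / `SheafOfModules` are not reducible (as in Mathlib's `AlgebraicGeometry/Modules/Sheaf.lean`).
set_option backward.isDefEq.respectTransparency false

namespace Literature.AlgebraicGeometry.AbelianSchemes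

namespace AbelianSchemeOver

open Literature.AlgebraicGeometry.Motives Literature.AlgebraicGeometry.AbelianVarieties
  Literature.AlgebraicGeometry.Modules

variable {S : Scheme.{u}} {A : AbelianSchemeOver S}

namespace DualPair

variable (D : A.DualPair) [IsReduced S]

/-- **`𝒫|_{A × {ε_Â}} ≅ 𝒪` over a REDUCED base from a homomorphism `λ : A → Â` that is `Λ(𝒪(Θ_s))` at every geometric point `s`**:
the family `(1_A × ε_Â)^*𝒫` on `A_S` is rigidified and fibrewise in `Pic⁰` (★ `RigidifiedLineBundleTensor`), trivial on every geometric
fibre (★ `nonempty_pullback_fst_unitHatSlice_iso_of_isLambdaOfAt`), hence trivial (★ `nonempty_iso_unit_of_forall_fibre`), and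
`A_S = A ×_S S → A` is an isomorphism. [cite: MumfordFogartyKirwan1994, Ch. 6 §2 Definitions 6.2–6.3 (p. 120)] [cite: MumfordAV1970, §5 Cor. 6 (p. 54) and §13 (p. 125)] -/
theorem nonempty_unitHatSlice_iso_of_forall_isLambdaOfAt (lam : A.X ⟶ D.hat.X) [IsMonHom lam]
    (hΘ : ∀ (Ω : Type u) [Field Ω] [IsAlgClosed Ω] (s : Spec (.of Ω) ⟶ S),
      ∃ Θ : CartierDivisor (A.fibre s).toAbelianVariety.X.left, A.IsLambdaOfAt s D lam Θ) :
    Nonempty ((Scheme.Modules.pullback (unitHatSlice D)).obj D.P ≅ SheafOfModules.unit _) := by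
  -- the rigidified fibrewise-`Pic⁰` family `(1_A × ε_Â)^*𝒫` on `A_S`
  let ℒ : A.RigidifiedLineBundle (𝟙 S) :=
    ⟨D.pullbackP (𝟙 S) D.hat.unitSection D.hat.unitSection_comp_hom, D.hasRank_one_pullbackP _ _ _, D.rigid_pullbackP _ _ _⟩
  have hℒ : ℒ.FibrewisePicZero := D.fibrewisePicZero_pullbackP (𝟙 S) D.hat.unitSection D.hat.unitSection_comp_hom
  -- its module is the pull-back of `𝒫|_{A × {ε_Â}}` along the isomorphism `A_S → A`
  have eL : ℒ.L ≅ (Scheme.Modules.pullback (pullback.fst A.X.hom (𝟙 S))).obj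
      ((Scheme.Modules.pullback (unitHatSlice D)).obj D.P) :=
    (Scheme.Modules.pullbackCongr (baseChangeToProd_unitSection D)).app D.P ≪≫
      ((Scheme.Modules.pullbackComp _ _).app D.P).symm
  -- trivial on every geometric fibre
  have hfib : ∀ (Ω : Type u) [Field Ω] [IsAlgClosed Ω] (t : Spec (.of Ω) ⟶ S),
      Nonempty ((Scheme.Modules.pullback (A.restrictLeft (𝟙 S) t)).obj ℒ.L ≅ SheafOfModules.unit _) := by
    intro Ω _ _ t
    obtain ⟨Θ, hΘt⟩ := hΘ Ω (t ≫ 𝟙 S)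
    obtain ⟨i⟩ := nonempty_pullback_fst_unitHatSlice_iso_of_isLambdaOfAt D (t ≫ 𝟙 S) lam hΘt
    have hr : A.restrictLeft (𝟙 S) t ≫ pullback.fst A.X.hom (𝟙 S) ≫ unitHatSlice D =
        pullback.fst A.X.hom (t ≫ 𝟙 S) ≫ unitHatSlice D := by
      rw [← Category.assoc, restrictLeft_fst]
    exact ⟨(Scheme.Modules.pullback _).mapIso eL ≪≫ (Scheme.Modules.pullbackComp _ _).app _ ≪≫
      (Scheme.Modules.pullbackComp _ _).app D.P ≪≫ (Scheme.Modules.pullbackCongr hr).app D.P ≪≫ i⟩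
  -- hence trivial on `A_S`, and `A_S → A` has the section `(𝟙_A, π_A)`
  obtain ⟨j⟩ := nonempty_iso_unit_of_forall_fibre D ℒ hℒ hfib
  have hsec : pullback.lift (𝟙 A.X.left) A.X.hom (by rw [Category.id_comp, Category.comp_id]) ≫
      pullback.fst A.X.hom (𝟙 S) = 𝟙 _ := pullback.lift_fst _ _ _
  exact ⟨((Scheme.Modules.pullbackId (X := A.X.left)).app _).symm ≪≫ (Scheme.Modules.pullbackCongr hsec.symm).app _ ≪≫
    ((Scheme.Modules.pullbackComp _ _).app _).symm ≪≫ (Scheme.Modules.pullback _).mapIso (eL.symm ≪≫ j) ≪≫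
    RigidifiedLineBundle.pullbackUnitIso _⟩

end DualPair

/-- **THE UNIT HYPOTHESIS FROM A POLARISATION**: for a polarised abelian scheme `(A, D, pol)` over a reduced base,
`𝒫|_{A × {ε_Â}} ≅ 𝒪` (`pol.lam` is a homomorphism and `Λ(𝒪(Θ_s))` for an ample `Θ_s` at every geometric point — the fields of ★
`Polarization`).  This is the binder `hD` of ★ (P-⊗) / (SYM-n) / (K1)(K2) / `[n]^∨ = [n]`. [cite: MumfordFogartyKirwan1994, Ch. 6 §2 Definitions 6.2–6.3 (p. 120)] -/
theorem Polarization.nonempty_unitHatSlice_iso [IsReduced S] {D : A.DualPair} (pol : A.Polarization D) :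
    Nonempty ((Scheme.Modules.pullback (DualPair.unitHatSlice D)).obj D.P ≅ SheafOfModules.unit _) := by
  haveI := pol.isMonHom
  exact D.nonempty_unitHatSlice_iso_of_forall_isLambdaOfAt pol.lam fun Ω _ _ s =>
    (pol.exists_ample Ω s).imp fun _ h => h.2

end AbelianSchemeOver

end Literature.AlgebraicGeometry.AbelianSchemes

end
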